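import Summits.CriticalPhenomena.PercolationContinuityZ3.Theorems.PercNearOneGluingNoHeavyLowerTailSahiThreeDimFKG

/-!
# `NoHeavyLowerTail` (crux stmt-CriticalPhenomena-4575), Sahi programme P1: the three-dimensional reduction AT A FIXED ORDER `n`

Support file (Sahi cell, seat `prim-sahi-p1`, generation 3; `--supports stmt-CriticalPhenomena-4575`); appendix to
`…SahiThreeDimFKG`.

The reduction of `…SahiThreeDimFKG` (every FKG weight on a product of three finite chains is a monotone image of a PRODUCT
weight on a product of three finite chains) never changes the order `n` of the functional, so it holds order by order:
for each fixed `n`, **`C_n` for product probability weights on all 3-D grids `[a+1]×[b+1]×[c+1]` ⟺ `C_n` for all FKG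
probability weights on all products of three finite chains** (`prod₃_iff_fkg_prod₃_order`), and then `C_n` for all FKG
weights on every finite distributive lattice of J-width `≤ 3` (`sahiPositive_of_latticeEmbedding_prod₃_order`).  In
particular for `n = 3`: Kahn-type third-order positivity for product weights on three-dimensional grids is equivalent to
Sahi's `C₃` on the whole width-3 class.  The hypothesis is spelled out in each statement; nothing here asserts it.
Same proofs as in `…SahiThreeDimFKG`, with the order threaded through.  New mathematics, not in print.
-/

namespace Summit.CriticalPhenomena.PercolationContinuityZ3.Theorems.SahiThreeDim

open Finset Function Literature.Combinatorics.Sahi2008 SahiTwoDim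
open scoped BigOperators

noncomputable section

section Transport

variable {ι κ θ : Type*} [LinearOrder ι] [Fintype ι] [LinearOrder κ] [Fintype κ] [LinearOrder θ] [Fintype θ]

/-- **The hypothesis on arbitrary finite chains**: under the hypothesis `(H3)`, every product probability weight on a product
`(ι × κ) × θ` of three nonempty finite linear orders is Sahi-positive of every order (transport along order isomorphisms
with `Fin (a+1)`, `Fin (b+1)`, `Fin (c+1)`). (Fixed order `n`.) [this work] -/
theorem sahiPositive_prodWeight₃_order {n : ℕ}
    (H3 : ∀ (a b c : ℕ) (w₁ : Fin (a + 1) → ℝ) (w₂ : Fin (b + 1) → ℝ)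
      (w₃ : Fin (c + 1) → ℝ),
      (∀ i, 0 ≤ w₁ i) → ∑ i, w₁ i = 1 → (∀ j, 0 ≤ w₂ j) → ∑ j, w₂ j = 1 → (∀ k, 0 ≤ w₃ k) → ∑ k, w₃ k = 1 →
        SahiPositive (fun p : (Fin (a + 1) × Fin (b + 1)) × Fin (c + 1) => w₁ p.1.1 * w₂ p.1.2 * w₃ p.2) n)
    [Nonempty ι] [Nonempty κ] [Nonempty θ]
    (w₁ : ι → ℝ) (w₂ : κ → ℝ) (w₃ : θ → ℝ) (h₁0 : ∀ i, 0 ≤ w₁ i) (h₁1 : ∑ i, w₁ i = 1)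
    (h₂0 : ∀ j, 0 ≤ w₂ j) (h₂1 : ∑ j, w₂ j = 1) (h₃0 : ∀ k, 0 ≤ w₃ k) (h₃1 : ∑ k, w₃ k = 1) :
    SahiPositive (fun p : (ι × κ) × θ => w₁ p.1.1 * w₂ p.1.2 * w₃ p.2) n := by
  classical
  obtain ⟨a, ha⟩ : ∃ a, Fintype.card ι = a + 1 := Nat.exists_eq_succ_of_ne_zero Fintype.card_ne_zero
  obtain ⟨b, hb⟩ : ∃ b, Fintype.card κ = b + 1 := Nat.exists_eq_succ_of_ne_zero Fintype.card_ne_zero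
  obtain ⟨c, hc⟩ : ∃ c, Fintype.card θ = c + 1 := Nat.exists_eq_succ_of_ne_zero Fintype.card_ne_zero
  obtain ⟨e₁, -⟩ : ∃ e : Fin (a + 1) ≃o ι, True := ⟨Fintype.orderIsoFinOfCardEq ι ha, trivial⟩
  obtain ⟨e₂, -⟩ : ∃ e : Fin (b + 1) ≃o κ, True := ⟨Fintype.orderIsoFinOfCardEq κ hb, trivial⟩
  obtain ⟨e₃, -⟩ : ∃ e : Fin (c + 1) ≃o θ, True := ⟨Fintype.orderIsoFinOfCardEq θ hc, trivial⟩
  have hpos := H3 a b c (fun i => w₁ (e₁ i)) (fun j => w₂ (e₂ j)) (fun k => w₃ (e₃ k)) (fun i => h₁0 _)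
    (by rw [← h₁1]; exact e₁.toEquiv.sum_comp w₁) (fun j => h₂0 _) (by rw [← h₂1]; exact e₂.toEquiv.sum_comp w₂)
    (fun k => h₃0 _) (by rw [← h₃1]; exact e₃.toEquiv.sum_comp w₃)
  obtain ⟨E, hE⟩ : ∃ E : (Fin (a + 1) × Fin (b + 1)) × Fin (c + 1) ≃ (ι × κ) × θ,
      E = (e₁.toEquiv.prodCongr e₂.toEquiv).prodCongr e₃.toEquiv := ⟨_, rfl⟩
  have hEmono : Monotone E := fun p q h => by
    rw [hE]
    exact ⟨⟨e₁.monotone h.1.1, e₂.monotone h.1.2⟩, e₃.monotone h.2⟩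
  have hpush : pushWeight (fun p : (Fin (a + 1) × Fin (b + 1)) × Fin (c + 1) =>
      w₁ (e₁ p.1.1) * w₂ (e₂ p.1.2) * w₃ (e₃ p.2)) E = fun p : (ι × κ) × θ => w₁ p.1.1 * w₂ p.1.2 * w₃ p.2 := by
    funext p
    rw [pushWeight_equiv, hE]
    rcases p with ⟨⟨i, j⟩, k⟩
    simp
  rw [← hpush]
  exact SahiPositive.of_pushWeight hpos hEmono

end Transport

/-! ## The reduction at order `n` -/

section Main

variable {α : Type*} [LinearOrder α] [Fintype α]

/-- **Core of the three-dimensional reduction** (columns `Fin (b+1)`, `Fin (c+1)`): under the hypothesis `(H3)`, every FKG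
probability weight on `(α × Fin (b+1)) × Fin (c+1)` is Sahi-positive of every order. [this work] -/
theorem sahiPositive_of_isFKGMeasure_prod₃_fin_order {n : ℕ}
    (H3 : ∀ (a b c : ℕ) (w₁ : Fin (a + 1) → ℝ) (w₂ : Fin (b + 1) → ℝ)
      (w₃ : Fin (c + 1) → ℝ),
      (∀ i, 0 ≤ w₁ i) → ∑ i, w₁ i = 1 → (∀ j, 0 ≤ w₂ j) → ∑ j, w₂ j = 1 → (∀ k, 0 ≤ w₃ k) → ∑ k, w₃ k = 1 →
        SahiPositive (fun p : (Fin (a + 1) × Fin (b + 1)) × Fin (c + 1) => w₁ p.1.1 * w₂ p.1.2 * w₃ p.2) n)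
    {b c : ℕ} {μ : (α × Fin (b + 1)) × Fin (c + 1) → ℝ} (hμ : IsFKGMeasure μ) : SahiPositive μ n := by
  classical
  have hα : Nonempty α := by
    by_contra h
    rw [not_nonempty_iff] at h
    have h0 : ∑ p, μ p = 0 := by
      rw [Fintype.sum_prod_type, Fintype.sum_prod_type]
      exact Fintype.sum_empty _
    exact one_ne_zero (hμ.sum_eq_one.symm.trans h0)
  -- (1) the `(α × Fin (b+1))`-marginal `ν` is FKG
  obtain ⟨ν, hν⟩ : ∃ ν : α × Fin (b + 1) → ℝ, ν = fun p => ∑ u, μ (p, u) := ⟨_, rfl⟩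
  have hνFKG : IsFKGMeasure ν := by
    rw [hν, ← pushWeight_fst_eq]
    exact hμ.pushWeight_fst
  -- (2) level one: `ν` is the monotone image of `r ⊗ g₂` on `α × Fin K₂`
  obtain ⟨K₂, hK₂, g₂, hg₂0, hg₂1, G₂, hG₂mono, hG₂push⟩ := exists_coupling ν hνFKG.nonneg
    (fun i i' j hii' _ _ => SahiTwoDim.cdf_cross_of_mul_le_mul ν hνFKG.mul_le_mul hii' j)
  -- (3) level two: `μ` is the monotone image of `ν ⊗ g₃` on `(α × Fin (b+1)) × Fin K₃` (rows indexed by a lattice)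
  obtain ⟨K₃, hK₃, g₃, hg₃0, hg₃1, G₃, hG₃mono, hG₃push⟩ := exists_coupling μ hμ.nonneg
    (fun p p' u hpp' _ _ => cdf_cross_of_mul_le_mul μ hμ.mul_le_mul hpp' u)
  haveI : Nonempty (Fin K₂) := ⟨⟨0, hK₂⟩⟩
  haveI : Nonempty (Fin K₃) := ⟨⟨0, hK₃⟩⟩
  -- (4) `ν ⊗ g₃` is the monotone image of the PRODUCT weight `r ⊗ g₂ ⊗ g₃` on `(α × Fin K₂) × Fin K₃`
  have hr0 : ∀ i, 0 ≤ ∑ j, ν (i, j) := fun i => sum_nonneg fun j _ => hνFKG.nonneg _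
  have hr1 : ∑ i, (∑ j, ν (i, j)) = 1 := by rw [sum_rowMass, hνFKG.sum_eq_one]
  have hπ : SahiPositive (fun x : (α × Fin K₂) × Fin K₃ => (∑ j, ν (x.1.1, j)) * g₂ x.1.2 * g₃ x.2) n :=
    sahiPositive_prodWeight₃_order H3 (fun i => ∑ j, ν (i, j)) g₂ g₃ hr0 hr1 hg₂0 hg₂1 hg₃0 hg₃1
  have hFmono : Monotone (fun x : (α × Fin K₂) × Fin K₃ => (G₂ x.1, x.2)) :=
    fun x x' h => ⟨hG₂mono h.1, h.2⟩
  have hθ : SahiPositive (fun y : (α × Fin (b + 1)) × Fin K₃ => ν y.1 * g₃ y.2) n := by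
    have h := pushWeight_prodMap_id (fun p : α × Fin K₂ => (∑ j, ν (p.1, j)) * g₂ p.2) g₃ G₂
    rw [hG₂push] at h
    rw [← h]
    exact SahiPositive.of_pushWeight hπ hFmono
  -- (5) conclude
  have hθ' : (fun q : (α × Fin (b + 1)) × Fin K₃ => (∑ u, μ (q.1, u)) * g₃ q.2) =
      fun y => ν y.1 * g₃ y.2 := by
    funext q; rw [hν]
  rw [← hG₃push, hθ']
  exact SahiPositive.of_pushWeight hθ hG₃mono

/-- **Three-dimensional reduction.**  IF every product probability weight on every product of three finite chains is
Sahi-positive of every order (Lieb–Sahi's conjecture [LiebSahi2021, Conj. 1.1] for `[0,1]³`, discrete product form),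
THEN every FKG probability weight on every product `(α × β) × γ` of three finite chains is Sahi-positive of every order.
[this work] -/
theorem sahiPositive_of_isFKGMeasure_prod₃_order {n : ℕ}
    (H3 : ∀ (a b c : ℕ) (w₁ : Fin (a + 1) → ℝ) (w₂ : Fin (b + 1) → ℝ)
      (w₃ : Fin (c + 1) → ℝ),
      (∀ i, 0 ≤ w₁ i) → ∑ i, w₁ i = 1 → (∀ j, 0 ≤ w₂ j) → ∑ j, w₂ j = 1 → (∀ k, 0 ≤ w₃ k) → ∑ k, w₃ k = 1 →
        SahiPositive (fun p : (Fin (a + 1) × Fin (b + 1)) × Fin (c + 1) => w₁ p.1.1 * w₂ p.1.2 * w₃ p.2) n)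
    {β γ : Type*} [LinearOrder β] [Fintype β] [LinearOrder γ] [Fintype γ] {μ : (α × β) × γ → ℝ}
    (hμ : IsFKGMeasure μ) : SahiPositive μ n := by
  classical
  have hne : Nonempty ((α × β) × γ) := by
    by_contra h
    rw [not_nonempty_iff] at h
    exact one_ne_zero (hμ.sum_eq_one.symm.trans (Fintype.sum_empty _))
  obtain ⟨⟨⟨-, j₀⟩, k₀⟩⟩ := hne
  haveI : Nonempty β := ⟨j₀⟩
  haveI : Nonempty γ := ⟨k₀⟩
  obtain ⟨b, hb⟩ : ∃ b, Fintype.card β = b + 1 := Nat.exists_eq_succ_of_ne_zero Fintype.card_ne_zero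
  obtain ⟨c, hc⟩ : ∃ c, Fintype.card γ = c + 1 := Nat.exists_eq_succ_of_ne_zero Fintype.card_ne_zero
  obtain ⟨e₂, -⟩ : ∃ e : Fin (b + 1) ≃o β, True := ⟨Fintype.orderIsoFinOfCardEq β hb, trivial⟩
  obtain ⟨e₃, -⟩ : ∃ e : Fin (c + 1) ≃o γ, True := ⟨Fintype.orderIsoFinOfCardEq γ hc, trivial⟩
  obtain ⟨E, hE⟩ : ∃ E : (α × Fin (b + 1)) × Fin (c + 1) ≃ (α × β) × γ,
      E = ((Equiv.refl α).prodCongr e₂.toEquiv).prodCongr e₃.toEquiv := ⟨_, rfl⟩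
  have hEmono : Monotone E := fun p q h => by
    rw [hE]
    exact ⟨⟨h.1.1, e₂.monotone h.1.2⟩, e₃.monotone h.2⟩
  have hEinf : ∀ p q, E (p ⊓ q) = E p ⊓ E q := fun p q => by
    rw [hE]; ext <;> simp [e₂.map_inf, e₃.map_inf]
  have hEsup : ∀ p q, E (p ⊔ q) = E p ⊔ E q := fun p q => by
    rw [hE]; ext <;> simp [e₂.map_sup, e₃.map_sup]
  obtain ⟨μ', hμ'⟩ : ∃ μ' : (α × Fin (b + 1)) × Fin (c + 1) → ℝ, μ' = fun p => μ (E p) := ⟨_, rfl⟩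
  have hFKG : IsFKGMeasure μ' := by
    refine ⟨fun p => by rw [hμ']; exact hμ.nonneg _, ?_, fun p q => ?_⟩
    · rw [hμ', ← hμ.sum_eq_one]
      exact E.sum_comp (fun p => μ p)
    · rw [hμ']
      have h := hμ.mul_le_mul (E p) (E q)
      rwa [← hEinf, ← hEsup] at h
  have hpush : pushWeight μ' E = μ := by
    funext q
    rw [pushWeight_equiv, hμ']
    exact congrArg μ (E.apply_symm_apply q)
  rw [← hpush]
  exact SahiPositive.of_pushWeight (sahiPositive_of_isFKGMeasure_prod₃_fin_order H3 hFKG) hEmono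

/-- The same for the right-associated product `α × (β × γ)`. [this work] -/
theorem sahiPositive_of_isFKGMeasure_prod₃_order' {n : ℕ}
    (H3 : ∀ (a b c : ℕ) (w₁ : Fin (a + 1) → ℝ) (w₂ : Fin (b + 1) → ℝ)
      (w₃ : Fin (c + 1) → ℝ),
      (∀ i, 0 ≤ w₁ i) → ∑ i, w₁ i = 1 → (∀ j, 0 ≤ w₂ j) → ∑ j, w₂ j = 1 → (∀ k, 0 ≤ w₃ k) → ∑ k, w₃ k = 1 →
        SahiPositive (fun p : (Fin (a + 1) × Fin (b + 1)) × Fin (c + 1) => w₁ p.1.1 * w₂ p.1.2 * w₃ p.2) n)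
    {β γ : Type*} [LinearOrder β] [Fintype β] [LinearOrder γ] [Fintype γ] {μ : α × β × γ → ℝ}
    (hμ : IsFKGMeasure μ) : SahiPositive μ n := by
  classical
  obtain ⟨E, hE⟩ : ∃ E : (α × β) × γ ≃ α × β × γ, E = Equiv.prodAssoc α β γ := ⟨_, rfl⟩
  have hEmono : Monotone E := fun p q h => by
    rw [hE]
    exact ⟨h.1.1, h.1.2, h.2⟩
  have hEinf : ∀ p q, E (p ⊓ q) = E p ⊓ E q := fun p q => by rw [hE]; rfl
  have hEsup : ∀ p q, E (p ⊔ q) = E p ⊔ E q := fun p q => by rw [hE]; rfl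
  obtain ⟨μ', hμ'⟩ : ∃ μ' : (α × β) × γ → ℝ, μ' = fun p => μ (E p) := ⟨_, rfl⟩
  have hFKG : IsFKGMeasure μ' := by
    refine ⟨fun p => by rw [hμ']; exact hμ.nonneg _, ?_, fun p q => ?_⟩
    · rw [hμ', ← hμ.sum_eq_one]
      exact E.sum_comp (fun p => μ p)
    · rw [hμ']
      have h := hμ.mul_le_mul (E p) (E q)
      rwa [← hEinf, ← hEsup] at h
  have hpush : pushWeight μ' E = μ := by
    funext q
    rw [pushWeight_equiv, hμ']
    exact congrArg μ (E.apply_symm_apply q)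
  rw [← hpush]
  exact SahiPositive.of_pushWeight (sahiPositive_of_isFKGMeasure_prod₃_order H3 hFKG) hEmono

/-- **Sublattices of three-dimensional grids.**  Under the hypothesis `(H3)`: if a finite distributive lattice `L` admits an
injective map into a product of three finite chains preserving `⊓` and `⊔` (equivalently, by Dilworth–Birkhoff, its poset
of join-irreducibles has width `≤ 3`), then every FKG probability weight on `L` is Sahi-positive of every order (push
forward — the weight stays FKG, `isFKGMeasure_pushWeight` — and descend along the monotone retraction
`p ↦ ⋁{x : e x ≤ p}`). [this work] -/
theorem sahiPositive_of_latticeEmbedding_prod₃_order {n : ℕ}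
    (H3 : ∀ (a b c : ℕ) (w₁ : Fin (a + 1) → ℝ) (w₂ : Fin (b + 1) → ℝ)
      (w₃ : Fin (c + 1) → ℝ),
      (∀ i, 0 ≤ w₁ i) → ∑ i, w₁ i = 1 → (∀ j, 0 ≤ w₂ j) → ∑ j, w₂ j = 1 → (∀ k, 0 ≤ w₃ k) → ∑ k, w₃ k = 1 →
        SahiPositive (fun p : (Fin (a + 1) × Fin (b + 1)) × Fin (c + 1) => w₁ p.1.1 * w₂ p.1.2 * w₃ p.2) n)
    {L : Type*} [DistribLattice L] [Fintype L]
    [DecidableEq L] {β γ : Type*} [LinearOrder β] [Fintype β] [LinearOrder γ] [Fintype γ]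
    (e : L → (α × β) × γ) (he : Function.Injective e) (hinf : ∀ x y, e (x ⊓ y) = e x ⊓ e y)
    (hsup : ∀ x y, e (x ⊔ y) = e x ⊔ e y) {μ : L → ℝ} (hμ : IsFKGMeasure μ) : SahiPositive μ n := by
  classical
  have hL : Nonempty L := by
    by_contra h
    rw [not_nonempty_iff] at h
    exact one_ne_zero (hμ.sum_eq_one.symm.trans (Fintype.sum_empty _))
  letI : OrderBot L := Fintype.toOrderBot L
  have hle : ∀ x y, e x ≤ e y ↔ x ≤ y := by
    intro x y
    constructor
    · intro h
      have h1 : e (x ⊓ y) = e x := by rw [hinf]; exact inf_eq_left.2 h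
      exact inf_eq_left.1 (he h1)
    · intro h
      have h1 : e x ⊓ e y = e x := by rw [← hinf, inf_eq_left.2 h]
      exact inf_eq_left.1 h1
  obtain ⟨R, hR⟩ : ∃ R : (α × β) × γ → L, ∀ p, R p = (univ.filter fun x => e x ≤ p).sup id := ⟨_, fun p => rfl⟩
  have hRmono : Monotone R := by
    intro p p' hpp'
    rw [hR, hR]
    refine Finset.sup_mono fun x hx => ?_
    rw [mem_filter] at hx ⊢
    exact ⟨hx.1, hx.2.trans hpp'⟩
  have hRE : ∀ x, R (e x) = x := by
    intro x
    rw [hR]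
    refine le_antisymm (Finset.sup_le fun y hy => ?_) ?_
    · rw [mem_filter] at hy
      exact (hle y x).1 hy.2
    · exact Finset.le_sup (f := id) (by rw [mem_filter]; exact ⟨mem_univ _, le_rfl⟩)
  have hFKG : IsFKGMeasure (pushWeight μ e) := isFKGMeasure_pushWeight hμ he hinf hsup
  exact SahiCubeAllOrders.sahiPositive_of_pushWeight_of_retract hRmono hRE
    (sahiPositive_of_isFKGMeasure_prod₃_order H3 hFKG)

end Main

/-! ## The equivalence at order `n` -/

section Iff

/-- **Lieb–Sahi for product weights on 3-D grids ⟺ Sahi for all FKG weights on 3-D grids.**  Sahi positivity of every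
order for every PRODUCT probability weight on every `[a+1] × [b+1] × [c+1]` is equivalent to Sahi positivity of every
order for every FKG probability weight on every product of three finite linear orders (and then, by
`sahiPositive_of_latticeEmbedding_prod₃_order`, on every finite distributive lattice of J-width `≤ 3`). [this work] -/
theorem prod₃_iff_fkg_prod₃_order (n : ℕ) :
    (∀ (a b c : ℕ) (w₁ : Fin (a + 1) → ℝ) (w₂ : Fin (b + 1) → ℝ)
      (w₃ : Fin (c + 1) → ℝ),
      (∀ i, 0 ≤ w₁ i) → ∑ i, w₁ i = 1 → (∀ j, 0 ≤ w₂ j) → ∑ j, w₂ j = 1 → (∀ k, 0 ≤ w₃ k) → ∑ k, w₃ k = 1 →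
        SahiPositive (fun p : (Fin (a + 1) × Fin (b + 1)) × Fin (c + 1) => w₁ p.1.1 * w₂ p.1.2 * w₃ p.2) n) ↔
      ∀ (α β γ : Type) [LinearOrder α] [Fintype α] [LinearOrder β] [Fintype β] [LinearOrder γ] [Fintype γ]
        (μ : (α × β) × γ → ℝ), IsFKGMeasure μ → SahiPositive μ n := by
  constructor
  · intro H3 α β γ _ _ _ _ _ _ μ hμ
    exact sahiPositive_of_isFKGMeasure_prod₃_order H3 hμ
  · intro H a b c w₁ w₂ w₃ h₁0 h₁1 h₂0 h₂1 h₃0 h₃1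
    exact H (Fin (a + 1)) (Fin (b + 1)) (Fin (c + 1)) _ (isFKGMeasure_prod₃ w₁ w₂ w₃ h₁0 h₁1 h₂0 h₂1 h₃0 h₃1)

end Iff

end

end Summit.CriticalPhenomena.PercolationContinuityZ3.Theorems.SahiThreeDim
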